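import Mathlib
import HarnessLib

/-!
# The tower step: a stable line avoiding a hyperplane without stable lines is a complement (Phase 0 tower analysis, crux `WildQuotients.WildQuotientResolution`)

Crux stmt-ResolutionOfSingularities-15640 (`WildQuotientResolution`), registered stub
`stub_phaseZeroHighDim`, move-game track (`Theorems/…PointMove`, `…FlagStepPoint`). Linear-algebra
core of the statement "a tower of point moves with constant non-p-closed inertia is CURVILINEAR"
(this hand's evidence memo `PHASE0-DIM3-TERMINATION.md`, §2): at a storey `x` of the tower the
tangent space `V = T_x` contains the tangent hyperplane `W = T_x E` of the last exceptional divisor,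
on which the inertia `I` acts (through a twist of its action one storey below) WITHOUT a stable
line — a non-p-closed finite subgroup of `GL₂` fixes no line (`FlagCoreGeneral`: a fixed line would
put it in a Borel subgroup, which is p-closed). The next storey is an `I`-fixed point of `ℙ(V)`,
i.e. an `I`-stable line `L ⊆ V`; the lemma says `L ∩ W = 0` and `L + W = V`: the next point lies
OFF the strict transform of `E`, and `V/L ≅ W` as `I`-modules, so the hypothesis reproduces itself.
Pure linear algebra over a division ring; the "action" is any family of linear endomorphisms.

* `inf_eq_bot_of_no_stable_line` — a stable line not allowed inside `W` meets `W` trivially.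
* `isCompl_of_stable_line_of_finrank_quotient_eq_one` — if moreover `W` is a hyperplane
  (`finrank (V ⧸ W) = 1`), the stable line is a complement of `W`.

[OURS · crux stmt-ResolutionOfSingularities-15640 · helper toward `stub_phaseZeroHighDim`
(termination of the point-move towers, dim 3); folklore linear algebra, counted 0; AI-level work,
weaker than expert review.]
-/

-- single-problem summit: the doubled namespace component `ResolutionOfSingularities` is forced
set_option linter.dupNamespace false

namespace Summit.ResolutionOfSingularities.ResolutionOfSingularities.Theorems.WildQuotientResolution.TowerStep

variable {K : Type*} [DivisionRing K] {V : Type*} [AddCommGroup V] [Module K V]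

/-- **A stable line not inside `W` meets `W` trivially.** Let `f i` (`i : ι`) be linear
endomorphisms of `V`, `W ≤ V` a submodule containing NO line (submodule of rank `1`) stable under
every `f i`, and `L` a stable line. Then `L ⊓ W = ⊥`. [folklore] -/
theorem inf_eq_bot_of_no_stable_line {ι : Type*} (f : ι → V →ₗ[K] V) (W L : Submodule K V)
    (hW : ∀ L' : Submodule K V, L' ≤ W → Module.finrank K L' = 1 →
      ¬ ∀ i, L' ≤ L'.comap (f i))
    (hL1 : Module.finrank K L = 1) (hLs : ∀ i, L ≤ L.comap (f i)) : L ⊓ W = ⊥ := by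
  by_contra hne
  -- `L ⊓ W` is a non-zero submodule of the line `L`, hence all of `L`
  haveI : Module.Finite K L := Module.finite_of_finrank_eq_succ hL1
  have hle : L ⊓ W ≤ L := inf_le_left
  have hpos : 0 < Module.finrank K ↥(L ⊓ W) := by
    rw [Module.finrank_pos_iff_exists_ne_zero]
    obtain ⟨v, hv, hv0⟩ := (Submodule.ne_bot_iff _).mp hne
    exact ⟨⟨v, hv⟩, fun h => hv0 (congrArg Subtype.val h)⟩
  have hle1 : Module.finrank K ↥(L ⊓ W) ≤ 1 := hL1 ▸ Submodule.finrank_mono hle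
  have heq1 : Module.finrank K ↥(L ⊓ W) = 1 := le_antisymm hle1 hpos
  have heq : L ⊓ W = L := Submodule.eq_of_le_of_finrank_eq hle (by rw [heq1, hL1])
  have hLW : L ≤ W := heq ▸ inf_le_right
  exact hW L hLW hL1 hLs

/-- **The tower step.** In a finite-dimensional `V`, let `W` be a hyperplane
(`finrank (V ⧸ W) = 1`) containing no line stable under the endomorphisms `f i`, and `L` a stable
line. Then `L` is a complement of `W`: `L ⊓ W = ⊥` and `L ⊔ W = ⊤`. (Along a tower of point
blow-ups with constant inertia: the next centre lies off the old exceptional divisor, and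
`V/L ≅ W` equivariantly.) [folklore] -/
theorem isCompl_of_stable_line_of_finrank_quotient_eq_one [FiniteDimensional K V] {ι : Type*}
    (f : ι → V →ₗ[K] V) (W L : Submodule K V) (hWq : Module.finrank K (V ⧸ W) = 1)
    (hW : ∀ L' : Submodule K V, L' ≤ W → Module.finrank K L' = 1 →
      ¬ ∀ i, L' ≤ L'.comap (f i))
    (hL1 : Module.finrank K L = 1) (hLs : ∀ i, L ≤ L.comap (f i)) : IsCompl L W := by
  have hinf : L ⊓ W = ⊥ := inf_eq_bot_of_no_stable_line f W L hW hL1 hLs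
  refine IsCompl.of_eq hinf ?_
  -- dimension count: `dim (L ⊔ W) = dim L + dim W - dim (L ⊓ W) = 1 + dim W = dim V`
  have hsum := Submodule.finrank_sup_add_finrank_inf_eq L W
  rw [hinf, finrank_bot, add_zero, hL1] at hsum
  have hV : Module.finrank K V = 1 + Module.finrank K W := by
    have h := Submodule.finrank_quotient_add_finrank W
    rw [hWq] at h
    exact h.symm
  exact Submodule.eq_top_of_finrank_eq (by rw [hsum, hV])

end Summit.ResolutionOfSingularities.ResolutionOfSingularities.Theorems.WildQuotientResolution.TowerStep
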